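import Summits.ResolutionOfSingularities.ResolutionOfSingularities.Theorems.FrobeniusLadderFInjectiveMacaulayficationODPCurveCentre
import Summits.ResolutionOfSingularities.ResolutionOfSingularities.Theorems.FrobeniusLadderFInjectiveMacaulayficationStrictTransformGraphType
import Summits.ResolutionOfSingularities.ResolutionOfSingularities.Theorems.EquisingularLiftEquisingularLiftNatSpecimenQuarticDerivations
import Literature.AlgebraicGeometry.Resolution.RegularDerivationQuotient
import Literature.AlgebraicGeometry.Resolution.DerivativeIdealsLocalization
import Literature.AlgebraicGeometry.Resolution.SmoothStandardSmoothRetract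
import Literature.AlgebraicGeometry.Resolution.RegularCentreLocal
import Literature.AlgebraicGeometry.Resolution.AffineBlowupResolutionCriterion
import HarnessLib

/-!
# The blowing up of the compound-ODP hypersurface `a′b′ + w·g = 0` along its singular curve `(a′, b′, w, g)` IS REGULAR
# (E4″@G T-side (F3-w), part 2 of 3; crux `FInjectiveMacaulayfication` stmt-ResolutionOfSingularities-15315, chain w45a; res-L1-w45a-plan-1 R18.32 / R19.1
# «stub-1 g11 = (F3-w) then (F3) glue»; typing plan res-L1-w45a-stub-3 g9 `E4-STEP-TYPING.md` §B (F3) route (R-a); seat res-L1-w45a-stub-1 g11)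

[OURS · L1 W4.5a] Support file (`--supports stmt-ResolutionOfSingularities-15315 --as helper`); replaces the role of NO printed item; NOT a statement of any
manuscript; def-free; UNCONDITIONAL; commutative algebra + one scheme sentence. AI-written (AI review is weaker than expert review).

SETTING (generic, as in `ODPCurveCentre`). `Λ` a REGULAR ring with a derivation `D₀` (over any base `S₀`) such that `D₀ g` is a unit modulo `g` and `Λ/(g)` a domain
(so `Λ/(g)` is a regular domain, Stacks 07PF); `R = Λ[T₀, T₁, T₂]`, `cen = (T₀, T₁, T₂, C g)`, `I = (cen)`, `h = T₀T₁ + T₂·C g`, `C_w = R/(h)`, `J = I·C_w`.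
* §1 `isRegularRing_localization_quotient_of_derivations` — generic Stacks 07PF on a localisation `L` of a regular ring `R`: `L/(h)` is regular if at every prime
  `Q ∋ h` of `L` some derivation `D` of `R` has `D h ∉ Q` (derivations extend to localisations, `DerivativeIdealsLocalization`).
* §2 `hoff_zero/one/three/two` — the hypersurface `h` is regular off `V(T₀)`, `V(T₁)`, `V(C g)`, `V(T₂)`: `∂_{T₁} h = T₀`, `∂_{T₀} h = T₁`, `∂_{T₂} h = C g` are units
  there; on `T₂ ≠ 0` the three derivations `∂_{T₀}, ∂_{T₁}` and the coefficientwise extension `D̃₀` of `D₀` (`D̃₀ h = T₂ · C(D₀ g)`) have no common zero on `V(h)`.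
* §3 `isRegularRing_chart` — the four instances of res-L1-w45a-stub-1 g10's ★★ `StrictTransformGraphType.isRegularRing_quotient_odp` (p627049):
  `R[I/cen p]/(h′_p)` is a regular ring, `h′_p = x_{p′}/x_p + (x_q/x_p)(x_{q′}/x_p)`, `(p,p′,q,q′) ∈ {(0,1,2,3), (1,0,2,3), (2,3,0,1), (3,2,0,1)}`.
* §4 ★★ `isRegularRing_blowupAlgebra_strictTransform` — `C_w[J/c̄_p]` IS A REGULAR RING for each of the four generators (`BlowupAlgebraStrictTransform.
  quotientKerBlowupAlgebraMapEquiv`: `C_w[J/c̄_p] ≅ R[I/cen p]/(h′_p)`, GW 13.96 (2)); ★★ `isRegular_affineBlowup_strictTransform` — **`Bl_J Spec C_w` IS A REGULAR SCHEME**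
  (`affineBlowup.isRegular_of_isRegularRing_blowupAlgebra`).
* §5 `map_le_of_not_isRegularLocalRing` — conversely to `ODPCurveCentre.not_isRegularLocalRing_of_le`: a prime `P` of `C_w` with `(C_w)_P` not regular contains `J`
  (Stacks 07PF with the four derivations); `not_isRegularLocalRing_iff_le` — **`Sing(Spec C_w) = V(J)`** (the (F2) chart identification, ring side).
On floor 2 of E4″ (`Λ = k[U,V]`, `g = 1 + U³ + V³`, char 2, `D₀ = U∂_U + V∂_V`, `D₀ g = g + 1`) this is the regularity of the blowing up of the `w`-chart of `Bl_𝔪 G` along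
its singular curve `E` — part 3. [folklore; cite: Liu2002, Thm. 8.1.19 (a)] [cite: StacksProject, Tag 07PF; Tag 0BIQ] [cite: GortzWedhorn2020, Prop. 13.96 (2), (13.19)]
-/

-- single-problem summit: the doubled namespace component is forced
set_option linter.dupNamespace false

noncomputable section

namespace Summit.ResolutionOfSingularities.ResolutionOfSingularities.Theorems.FInjectiveMacaulayfication.ODPCurveBlowupRegular

open MvPolynomial Literature.AlgebraicGeometry.Resolution AlgebraicGeometry
open Summit.ResolutionOfSingularities.ResolutionOfSingularities.Theorems.FInjectiveMacaulayfication
open Summit.ResolutionOfSingularities.ResolutionOfSingularities.Theorems.EquisingularLift.SpecimenQuartic (isRegularRing_quotient_of_derivations)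
open Summit.ResolutionOfSingularities.ResolutionOfSingularities.Cruxes.EquisingularLiftNat.Sections (prime_algebraMap_of_isQuasiRegular)

universe u v

/-! ## §1 Stacks 07PF on a localisation, with derivations of the base ring -/

/-- **`L/(h)` is regular if the derivations of `R` separate the primes of `V(h) ⊂ Spec L`**, `L` a localisation of the regular ring `R`: every derivation of `R`
extends to `L` (`exists_derivation_extend_of_isLocalization`), `L` is regular (`isRegularRing_of_isLocalization`), and Stacks 07PF in its local form
(`isRegularRing_quotient_of_derivations`) applies. [cite: StacksProject, Tag 07PF] -/
theorem isRegularRing_localization_quotient_of_derivations {R L : Type u} [CommRing R] [CommRing L] [Algebra R L] [IsRegularRing R]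
    (M : Submonoid R) [IsLocalization M L] {S₀ : Type v} [CommRing S₀] [Algebra S₀ R] [Algebra S₀ L] [IsScalarTower S₀ R L] (h : R)
    (hD : ∀ Q : Ideal L, Q.IsPrime → algebraMap R L h ∈ Q → ∃ D : Derivation S₀ R R, algebraMap R L (D h) ∉ Q) :
    IsRegularRing (L ⧸ Ideal.span {algebraMap R L h}) := by
  haveI : IsRegularRing L := isRegularRing_of_isLocalization M L
  refine isRegularRing_quotient_of_derivations (S₀ := S₀) (algebraMap R L h) fun Q hQ hhQ => ?_
  obtain ⟨D, hDh⟩ := hD Q hQ hhQ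
  obtain ⟨D', hD'⟩ := exists_derivation_extend_of_isLocalization S₀ L M D
  exact ⟨D', by rw [hD']; exact hDh⟩

/-- A unit of `L` lies in no prime ideal. [plumbing] -/
theorem not_mem_of_isUnit {L : Type u} [CommRing L] {Q : Ideal L} (hQ : Q.IsPrime) {a : L} (ha : IsUnit a) : a ∉ Q :=
  fun h => hQ.ne_top (Ideal.eq_top_of_isUnit_mem Q h ha)

variable {Λ : Type u} [CommRing Λ] (g : Λ) (cen : Fin 4 → MvPolynomial (Fin 3) Λ) (h : MvPolynomial (Fin 3) Λ)

/-! ## §2 The hypersurface `h = T₀T₁ + T₂·C g` is regular off each `V(cen p)` -/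

/-- `∂_{T₁} h = T₀`, `∂_{T₀} h = T₁`, `∂_{T₂} h = C g`. [plumbing] -/
theorem pderiv_h (hh : h = X 0 * X 1 + X 2 * C g) :
    (pderiv 1 : Derivation Λ (MvPolynomial (Fin 3) Λ) (MvPolynomial (Fin 3) Λ)) h = X 0 ∧
      (pderiv 0 : Derivation Λ (MvPolynomial (Fin 3) Λ) (MvPolynomial (Fin 3) Λ)) h = X 1 ∧
        (pderiv 2 : Derivation Λ (MvPolynomial (Fin 3) Λ) (MvPolynomial (Fin 3) Λ)) h = C g := by
  subst hh
  refine ⟨?_, ?_, ?_⟩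
  · simp only [map_add, Derivation.leibniz, pderiv_X_self, pderiv_X_of_ne (show (0 : Fin 3) ≠ 1 by decide),
      pderiv_X_of_ne (show (2 : Fin 3) ≠ 1 by decide), pderiv_C, smul_eq_mul, mul_zero, mul_one, add_zero]
  · simp only [map_add, Derivation.leibniz, pderiv_X_self, pderiv_X_of_ne (show (1 : Fin 3) ≠ 0 by decide),
      pderiv_X_of_ne (show (2 : Fin 3) ≠ 0 by decide), pderiv_C, smul_eq_mul, mul_zero, mul_one, add_zero, zero_add]
  · simp only [map_add, Derivation.leibniz, pderiv_X_self, pderiv_X_of_ne (show (0 : Fin 3) ≠ 2 by decide),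
      pderiv_X_of_ne (show (1 : Fin 3) ≠ 2 by decide), pderiv_C, smul_eq_mul, mul_zero, mul_one, add_zero, zero_add]

/-- `D̃₀ h = T₂ · C(D₀ g)` for the coefficientwise extension `D̃₀` of a derivation `D₀` of `Λ` (it kills the variables). [plumbing] -/
theorem coeffwiseDerivation_h {S₀ : Type v} [CommRing S₀] [Algebra S₀ Λ] (D₀ : Derivation S₀ Λ Λ) (hh : h = X 0 * X 1 + X 2 * C g) :
    coeffwiseDerivation (ι := Fin 3) D₀ h = X 2 * C (D₀ g) := by
  subst hh
  simp only [map_add, Derivation.leibniz, coeffwiseDerivation_X, coeffwiseDerivation_C, smul_eq_mul, mul_zero, add_zero, zero_add]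

/-- A unit modulo `g`: `D₀ g · s = 1 + g · t`. [plumbing] -/
theorem exists_mul_eq_one_add {S₀ : Type v} [CommRing S₀] [Algebra S₀ Λ] (D₀ : Derivation S₀ Λ Λ)
    (hD₀ : IsUnit (Ideal.Quotient.mk (Ideal.span {g}) (D₀ g))) : ∃ s t : Λ, D₀ g * s = 1 + g * t := by
  obtain ⟨v, hv⟩ := hD₀.exists_right_inv
  obtain ⟨s, rfl⟩ := Ideal.Quotient.mk_surjective v
  rw [← map_mul, ← map_one (Ideal.Quotient.mk (Ideal.span {g})), Ideal.Quotient.eq, Ideal.mem_span_singleton'] at hv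
  obtain ⟨t, ht⟩ := hv
  exact ⟨s, t, by linear_combination -ht⟩

/-- **`hoff` on the chart `T₀`**: `R[1/T₀]/(h)` is a regular ring (`∂_{T₁} h = T₀` is a unit there). [folklore; cite: StacksProject, Tag 07PF] -/
theorem hoff_zero [IsRegularRing Λ] (hcen : cen = ![X 0, X 1, X 2, C g]) (hh : h = X 0 * X 1 + X 2 * C g) :
    IsRegularRing (Localization.Away (cen 0) ⧸ Ideal.span {algebraMap (MvPolynomial (Fin 3) Λ) (Localization.Away (cen 0)) (cen 0 * cen 1 + cen 2 * cen 3)}) := by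
  obtain ⟨h0, -, -, -⟩ := ODPCurveCentre.cen_apply g cen hcen
  rw [← (ODPCurveCentre.h_eq_odp g cen h hcen hh).1]
  refine isRegularRing_localization_quotient_of_derivations (S₀ := Λ) (Submonoid.powers (cen 0)) h fun Q hQ _ => ⟨pderiv 1, ?_⟩
  rw [(pderiv_h g h hh).1, ← h0]
  exact not_mem_of_isUnit hQ (IsLocalization.Away.algebraMap_isUnit (cen 0))

/-- **`hoff` on the chart `T₁`**: `R[1/T₁]/(h)` is a regular ring (`∂_{T₀} h = T₁`). [folklore; cite: StacksProject, Tag 07PF] -/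
theorem hoff_one [IsRegularRing Λ] (hcen : cen = ![X 0, X 1, X 2, C g]) (hh : h = X 0 * X 1 + X 2 * C g) :
    IsRegularRing (Localization.Away (cen 1) ⧸ Ideal.span {algebraMap (MvPolynomial (Fin 3) Λ) (Localization.Away (cen 1)) (cen 1 * cen 0 + cen 2 * cen 3)}) := by
  obtain ⟨-, h1, -, -⟩ := ODPCurveCentre.cen_apply g cen hcen
  rw [← (ODPCurveCentre.h_eq_odp g cen h hcen hh).2.1]
  refine isRegularRing_localization_quotient_of_derivations (S₀ := Λ) (Submonoid.powers (cen 1)) h fun Q hQ _ => ⟨pderiv 0, ?_⟩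
  rw [(pderiv_h g h hh).2.1, ← h1]
  exact not_mem_of_isUnit hQ (IsLocalization.Away.algebraMap_isUnit (cen 1))

/-- **`hoff` on the chart `C g`**: `R[1/g]/(h)` is a regular ring (`∂_{T₂} h = C g`). [folklore; cite: StacksProject, Tag 07PF] -/
theorem hoff_three [IsRegularRing Λ] (hcen : cen = ![X 0, X 1, X 2, C g]) (hh : h = X 0 * X 1 + X 2 * C g) :
    IsRegularRing (Localization.Away (cen 3) ⧸ Ideal.span {algebraMap (MvPolynomial (Fin 3) Λ) (Localization.Away (cen 3)) (cen 3 * cen 2 + cen 0 * cen 1)}) := by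
  obtain ⟨-, -, -, h3⟩ := ODPCurveCentre.cen_apply g cen hcen
  rw [← (ODPCurveCentre.h_eq_odp g cen h hcen hh).2.2.2]
  refine isRegularRing_localization_quotient_of_derivations (S₀ := Λ) (Submonoid.powers (cen 3)) h fun Q hQ _ => ⟨pderiv 2, ?_⟩
  rw [(pderiv_h g h hh).2.2, ← h3]
  exact not_mem_of_isUnit hQ (IsLocalization.Away.algebraMap_isUnit (cen 3))

/-- ★ **`hoff` on the chart `T₂ = w`**: `R[1/T₂]/(h)` is a regular ring. At a prime `Q ∋ h` of `L = R[1/T₂]`: if `T₀ ∉ Q` use `∂_{T₁}`; if `T₁ ∉ Q` use `∂_{T₀}`; if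
`T₀, T₁ ∈ Q` then `T₂·C g = h − T₀T₁ ∈ Q`, so `C g ∈ Q` (`T₂` a unit), and the coefficientwise extension of `D₀` has value `T₂·C(D₀ g) ∉ Q` — for
`D₀ g · s = 1 + g·t` would otherwise put `1 ∈ Q`. [folklore; cite: StacksProject, Tag 07PF] -/
theorem hoff_two [IsRegularRing Λ] {S₀ : Type v} [CommRing S₀] [Algebra S₀ Λ] (D₀ : Derivation S₀ Λ Λ)
    (hD₀ : IsUnit (Ideal.Quotient.mk (Ideal.span {g}) (D₀ g))) (hcen : cen = ![X 0, X 1, X 2, C g]) (hh : h = X 0 * X 1 + X 2 * C g) :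
    IsRegularRing (Localization.Away (cen 2) ⧸ Ideal.span {algebraMap (MvPolynomial (Fin 3) Λ) (Localization.Away (cen 2)) (cen 2 * cen 3 + cen 0 * cen 1)}) := by
  obtain ⟨h0, h1, h2, h3⟩ := ODPCurveCentre.cen_apply g cen hcen
  obtain ⟨hd1, hd0, -⟩ := pderiv_h g h hh
  obtain ⟨s, t, hst⟩ := exists_mul_eq_one_add g D₀ hD₀
  rw [← (ODPCurveCentre.h_eq_odp g cen h hcen hh).2.2.1]
  refine isRegularRing_localization_quotient_of_derivations (S₀ := S₀) (Submonoid.powers (cen 2)) h fun Q hQ hhQ => ?_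
  by_cases hx0 : algebraMap (MvPolynomial (Fin 3) Λ) (Localization.Away (cen 2)) (X 0) ∈ Q
  · by_cases hx1 : algebraMap (MvPolynomial (Fin 3) Λ) (Localization.Away (cen 2)) (X 1) ∈ Q
    · -- both `T₀, T₁ ∈ Q`: the coefficientwise extension of `D₀`
      refine ⟨coeffwiseDerivation (ι := Fin 3) D₀, ?_⟩
      rw [coeffwiseDerivation_h g h D₀ hh, map_mul]
      intro hmem
      have hu : IsUnit (algebraMap (MvPolynomial (Fin 3) Λ) (Localization.Away (cen 2)) (X 2)) := by
        rw [← h2]; exact IsLocalization.Away.algebraMap_isUnit (cen 2)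
      have hDg : algebraMap (MvPolynomial (Fin 3) Λ) (Localization.Away (cen 2)) (C (D₀ g)) ∈ Q :=
        (hQ.mem_or_mem hmem).resolve_left (not_mem_of_isUnit hQ hu)
      -- `C g ∈ Q`: `T₂ · C g = h - T₀ T₁`
      have hg' : algebraMap (MvPolynomial (Fin 3) Λ) (Localization.Away (cen 2)) (X 2) *
          algebraMap (MvPolynomial (Fin 3) Λ) (Localization.Away (cen 2)) (C g) ∈ Q := by
        have : algebraMap (MvPolynomial (Fin 3) Λ) (Localization.Away (cen 2)) (X 2 * C g) =
            algebraMap (MvPolynomial (Fin 3) Λ) (Localization.Away (cen 2)) h -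
              algebraMap (MvPolynomial (Fin 3) Λ) (Localization.Away (cen 2)) (X 0) *
                algebraMap (MvPolynomial (Fin 3) Λ) (Localization.Away (cen 2)) (X 1) := by
          rw [hh, map_add, map_mul, map_mul]; ring
        rw [← map_mul, this]
        exact Q.sub_mem hhQ (Q.mul_mem_right _ hx0)
      have hgQ : algebraMap (MvPolynomial (Fin 3) Λ) (Localization.Away (cen 2)) (C g) ∈ Q :=
        (hQ.mem_or_mem hg').resolve_left (not_mem_of_isUnit hQ hu)
      -- `1 = C(D₀ g)·C s - C g·C t ∈ Q`
      apply hQ.ne_top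
      rw [Ideal.eq_top_iff_one]
      have hC : (C (D₀ g) * C s - C g * C t : MvPolynomial (Fin 3) Λ) = 1 := by
        rw [← map_mul, ← map_mul, ← map_sub, hst, add_sub_cancel_right, map_one]
      have h1 : algebraMap (MvPolynomial (Fin 3) Λ) (Localization.Away (cen 2)) (C (D₀ g)) *
            algebraMap (MvPolynomial (Fin 3) Λ) (Localization.Away (cen 2)) (C s) -
          algebraMap (MvPolynomial (Fin 3) Λ) (Localization.Away (cen 2)) (C g) *
            algebraMap (MvPolynomial (Fin 3) Λ) (Localization.Away (cen 2)) (C t) = 1 := by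
        have := congrArg (algebraMap (MvPolynomial (Fin 3) Λ) (Localization.Away (cen 2))) hC
        simpa only [map_sub, map_mul, map_one] using this
      rw [← h1]
      exact Q.sub_mem (Q.mul_mem_right _ hDg) (Q.mul_mem_right _ hgQ)
    · exact ⟨(pderiv 0 : Derivation Λ (MvPolynomial (Fin 3) Λ) (MvPolynomial (Fin 3) Λ)).restrictScalars S₀,
        by rw [Derivation.restrictScalars_apply, hd0]; exact hx1⟩
  · exact ⟨(pderiv 1 : Derivation Λ (MvPolynomial (Fin 3) Λ) (MvPolynomial (Fin 3) Λ)).restrictScalars S₀,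
      by rw [Derivation.restrictScalars_apply, hd1]; exact hx0⟩

/-! ## §3 The four chart instances of `StrictTransformGraphType.isRegularRing_quotient_odp` -/

/-- ★ **The four chart rings `R[I/cen p]/(h′_p)` are regular rings** (`h′_p = x_{p′}/x_p + (x_q/x_p)(x_{q′}/x_p)` the graph-type strict transform of `h`;
`Λ` regular, `D₀ g` a unit mod `g`, `Λ/(g)` a domain). [folklore; cite: Liu2002, Thm. 8.1.19 (a); StacksProject, Tag 0BIQ] -/
theorem isRegularRing_chart [IsRegularRing Λ] [IsDomain (Λ ⧸ Ideal.span {g})] (hg : IsSMulRegular Λ g) {S₀ : Type v} [CommRing S₀] [Algebra S₀ Λ]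
    (D₀ : Derivation S₀ Λ Λ) (hD₀ : IsUnit (Ideal.Quotient.mk (Ideal.span {g}) (D₀ g))) (hcen : cen = ![X 0, X 1, X 2, C g])
    (hh : h = X 0 * X 1 + X 2 * C g) :
    IsRegularRing (blowupAlgebra (Ideal.span (Set.range cen)) (cen 0) ⧸
        Ideal.span {blowupAlgebra.frac cen 0 1 + blowupAlgebra.frac cen 0 2 * blowupAlgebra.frac cen 0 3}) ∧
      IsRegularRing (blowupAlgebra (Ideal.span (Set.range cen)) (cen 1) ⧸
        Ideal.span {blowupAlgebra.frac cen 1 0 + blowupAlgebra.frac cen 1 2 * blowupAlgebra.frac cen 1 3}) ∧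
      IsRegularRing (blowupAlgebra (Ideal.span (Set.range cen)) (cen 2) ⧸
        Ideal.span {blowupAlgebra.frac cen 2 3 + blowupAlgebra.frac cen 2 0 * blowupAlgebra.frac cen 2 1}) ∧
      IsRegularRing (blowupAlgebra (Ideal.span (Set.range cen)) (cen 3) ⧸
        Ideal.span {blowupAlgebra.frac cen 3 2 + blowupAlgebra.frac cen 3 0 * blowupAlgebra.frac cen 3 1}) := by
  haveI : IsRegularRing (Λ ⧸ Ideal.span {g}) := isRegularRing_quotient_of_derivation g D₀ hD₀
  haveI := ODPCurveCentre.isDomain_quotient g cen hcen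
  haveI := ODPCurveCentre.isRegularRing_quotient g cen hcen
  have hx := ODPCurveCentre.isQuasiRegular_cen g cen hcen hg
  refine ⟨?_, ?_, ?_, ?_⟩
  · exact StrictTransformGraphType.isRegularRing_quotient_odp cen hx 0 1 2 3 (by decide) (by decide) (by decide) (by decide) (by decide)
      (hoff_zero g cen h hcen hh)
  · exact StrictTransformGraphType.isRegularRing_quotient_odp cen hx 1 0 2 3 (by decide) (by decide) (by decide) (by decide) (by decide)
      (hoff_one g cen h hcen hh)
  · exact StrictTransformGraphType.isRegularRing_quotient_odp cen hx 2 3 0 1 (by decide) (by decide) (by decide) (by decide) (by decide)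
      (hoff_two g cen h D₀ hD₀ hcen hh)
  · exact StrictTransformGraphType.isRegularRing_quotient_odp cen hx 3 2 0 1 (by decide) (by decide) (by decide) (by decide) (by decide)
      (hoff_three g cen h hcen hh)

/-! ## §4 The strict transform: the chart rings of `Bl_J Spec C_w` are regular; `Bl_J Spec C_w` is a regular scheme -/

/-- **One chart of the blowing up of `C_w = R/(h)` along `J = I·C_w` is a regular ring**, given the regularity of the corresponding graph-type quotient
`R[I/cen p]/(h′_p)`: the chart ring `C_w[J/c̄_p]` IS `R[I/cen p]/(h′_p)` (`BlowupAlgebraStrictTransform.quotientKerBlowupAlgebraMapEquiv` with `h = (cen p)²·h′_p`,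
`cen p` prime in `R[I/cen p]`, `cen p ∤ h′_p`). [cite: GortzWedhorn2020, Prop. 13.96 (2) and p. 416] [cite: StacksProject, Tag 0BIQ] -/
theorem isRegularRing_blowupAlgebra_map_of_chart [IsDomain (Λ ⧸ Ideal.span {g})] (hg : IsSMulRegular Λ g) (hcen : cen = ![X 0, X 1, X 2, C g])
    (J : Ideal (MvPolynomial (Fin 3) Λ ⧸ Ideal.span {h})) (hJ : J = (Ideal.span (Set.range cen)).map (Ideal.Quotient.mk (Ideal.span {h})))
    (p p' q q' : Fin 4) (hp' : p' ≠ p) (hq : q ≠ p) (hq' : q' ≠ p) (hqp' : q ≠ p') (hq'p' : q' ≠ p') (hodp : h = cen p * cen p' + cen q * cen q')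
    (hr : IsRegularRing (blowupAlgebra (Ideal.span (Set.range cen)) (cen p) ⧸
      Ideal.span {blowupAlgebra.frac cen p p' + blowupAlgebra.frac cen p q * blowupAlgebra.frac cen p q'})) :
    IsRegularRing (blowupAlgebra J (Ideal.Quotient.mk (Ideal.span {h}) (cen p))) := by
  haveI := ODPCurveCentre.isDomain_quotient g cen hcen
  have hx := ODPCurveCentre.isQuasiRegular_cen g cen hcen hg
  have hI : Ideal.span (Set.range cen) ≠ ⊤ := fun htop =>
    (Ideal.Quotient.zero_ne_one_iff.mp (zero_ne_one' (MvPolynomial (Fin 3) Λ ⧸ Ideal.span (Set.range cen)))) htop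
  have hf : algebraMap (MvPolynomial (Fin 3) Λ) (blowupAlgebra (Ideal.span (Set.range cen)) (cen p)) h =
      algebraMap (MvPolynomial (Fin 3) Λ) (blowupAlgebra (Ideal.span (Set.range cen)) (cen p)) (cen p) ^ 2 *
        (blowupAlgebra.frac cen p p' + blowupAlgebra.frac cen p q * blowupAlgebra.frac cen p q') := by
    rw [hodp]; exact StrictTransformGraphType.algebraMap_odp_eq cen p p' q q'
  have hprime := prime_algebraMap_of_isQuasiRegular cen p hx
  have hndvd := StrictTransformGraphType.not_dvd_odp cen hx hI p p' q q' hp' hq hq' hqp' hq'p'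
  subst hJ
  haveI := hr
  exact IsRegularRing.of_ringEquiv (R := blowupAlgebra (Ideal.span (Set.range cen)) (cen p) ⧸
      Ideal.span {blowupAlgebra.frac cen p p' + blowupAlgebra.frac cen p q * blowupAlgebra.frac cen p q'})
    (quotientKerBlowupAlgebraMapEquiv (Ideal.Quotient.mk (Ideal.span {h}))
      ((Ideal.span (Set.range cen)).map (Ideal.Quotient.mk (Ideal.span {h}))) Ideal.Quotient.mk_surjective le_rfl le_rfl
      Ideal.mk_ker hf hprime hndvd)

/-- ★★ **EVERY CHART RING `C_w[J/c̄_p]` (`p = 0, 1, 2, 3`) OF THE BLOWING UP OF `C_w = R/(h)` ALONG `J = (T₀, T₁, T₂, g)·C_w` IS A REGULAR RING** (`Λ` regular,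
`Λ/(g)` a domain, `g` a non-zero-divisor, `D₀ g` a unit modulo `g` for some derivation `D₀` of `Λ`). [folklore; cite: Liu2002, Thm. 8.1.19 (a)]
[cite: GortzWedhorn2020, Prop. 13.96 (2)] -/
theorem isRegularRing_blowupAlgebra_strictTransform [IsRegularRing Λ] [IsDomain (Λ ⧸ Ideal.span {g})] (hg : IsSMulRegular Λ g)
    {S₀ : Type v} [CommRing S₀] [Algebra S₀ Λ] (D₀ : Derivation S₀ Λ Λ) (hD₀ : IsUnit (Ideal.Quotient.mk (Ideal.span {g}) (D₀ g)))
    (hcen : cen = ![X 0, X 1, X 2, C g]) (hh : h = X 0 * X 1 + X 2 * C g)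
    (J : Ideal (MvPolynomial (Fin 3) Λ ⧸ Ideal.span {h})) (hJ : J = (Ideal.span (Set.range cen)).map (Ideal.Quotient.mk (Ideal.span {h}))) :
    ∀ p : Fin 4, IsRegularRing (blowupAlgebra J (Ideal.Quotient.mk (Ideal.span {h}) (cen p))) := by
  obtain ⟨r0, r1, r2, r3⟩ := isRegularRing_chart g cen h hg D₀ hD₀ hcen hh
  obtain ⟨e0, e1, e2, e3⟩ := ODPCurveCentre.h_eq_odp g cen h hcen hh
  intro p
  fin_cases p
  · exact isRegularRing_blowupAlgebra_map_of_chart g cen h hg hcen J hJ 0 1 2 3 (by decide) (by decide) (by decide) (by decide) (by decide) e0 r0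
  · exact isRegularRing_blowupAlgebra_map_of_chart g cen h hg hcen J hJ 1 0 2 3 (by decide) (by decide) (by decide) (by decide) (by decide) e1 r1
  · exact isRegularRing_blowupAlgebra_map_of_chart g cen h hg hcen J hJ 2 3 0 1 (by decide) (by decide) (by decide) (by decide) (by decide) e2 r2
  · exact isRegularRing_blowupAlgebra_map_of_chart g cen h hg hcen J hJ 3 2 0 1 (by decide) (by decide) (by decide) (by decide) (by decide) e3 r3

/-- ★★ **THE BLOWING UP `Bl_J Spec C_w` IS A REGULAR SCHEME** (`affineBlowup J`, covered by the spectra of the four regular chart rings;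
`affineBlowup.isRegular_of_isRegularRing_blowupAlgebra`). [folklore; cite: Liu2002, Thm. 8.1.19 (a)] [cite: GortzWedhorn2020, (13.19) and Def. 6.24] -/
theorem isRegular_affineBlowup_strictTransform [IsRegularRing Λ] [IsDomain (Λ ⧸ Ideal.span {g})] (hg : IsSMulRegular Λ g)
    {S₀ : Type v} [CommRing S₀] [Algebra S₀ Λ] (D₀ : Derivation S₀ Λ Λ) (hD₀ : IsUnit (Ideal.Quotient.mk (Ideal.span {g}) (D₀ g)))
    (hcen : cen = ![X 0, X 1, X 2, C g]) (hh : h = X 0 * X 1 + X 2 * C g)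
    (J : Ideal (MvPolynomial (Fin 3) Λ ⧸ Ideal.span {h})) (hJ : J = (Ideal.span (Set.range cen)).map (Ideal.Quotient.mk (Ideal.span {h}))) :
    Scheme.IsRegular (affineBlowup J) := by
  have hreg := isRegularRing_blowupAlgebra_strictTransform g cen h hg D₀ hD₀ hcen hh J hJ
  refine affineBlowup.isRegular_of_isRegularRing_blowupAlgebra (fun p : Fin 4 => Ideal.Quotient.mk (Ideal.span {h}) (cen p))
    (fun p => ?_) ?_ hreg
  · rw [hJ]; exact Ideal.mem_map_of_mem _ (Ideal.subset_span ⟨p, rfl⟩)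
  · rw [hJ, Ideal.map_span, ← Set.range_comp]
    exact le_rfl

/-! ## §5 The singular locus of `C_w` is exactly `V(J)` -/

/-- ★ **A singular point of `C_w = R/(h)` contains `J`**: if `(C_w)_P` is not regular then `T₀, T₁, C g, T₂ ∈ 𝔓 = P ∩ R` — the values `∂_{T₁}h`, `∂_{T₀}h`, `∂_{T₂}h` and, for
`T₂`, the value `T₂·C(D₀ g)` of the coefficientwise extension of `D₀` lie in `𝔓` (Stacks 07PF, `Derivation.apply_mem_comap_of_not_isRegularLocalRing`), and
`C(D₀ g) ∈ 𝔓` is excluded by `C g ∈ 𝔓`, `D₀ g·s = 1 + g·t`. [cite: StacksProject, Tag 07PF] -/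
theorem map_le_of_not_isRegularLocalRing [IsRegularRing Λ] {S₀ : Type v} [CommRing S₀] [Algebra S₀ Λ] (D₀ : Derivation S₀ Λ Λ)
    (hD₀ : IsUnit (Ideal.Quotient.mk (Ideal.span {g}) (D₀ g))) (hcen : cen = ![X 0, X 1, X 2, C g]) (hh : h = X 0 * X 1 + X 2 * C g)
    (P : Ideal (MvPolynomial (Fin 3) Λ ⧸ Ideal.span {h})) [P.IsPrime] (hP : ¬ IsRegularLocalRing (Localization.AtPrime P)) :
    (Ideal.span (Set.range cen)).map (Ideal.Quotient.mk (Ideal.span {h})) ≤ P := by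
  obtain ⟨h0, h1, h2, h3⟩ := ODPCurveCentre.cen_apply g cen hcen
  obtain ⟨hd1, hd0, hd2⟩ := pderiv_h g h hh
  obtain ⟨s, t, hst⟩ := exists_mul_eq_one_add g D₀ hD₀
  haveI hp : (P.comap (Ideal.Quotient.mk (Ideal.span {h}))).IsPrime := Ideal.comap_isPrime _ P
  have hX0 : (X 0 : MvPolynomial (Fin 3) Λ) ∈ P.comap (Ideal.Quotient.mk (Ideal.span {h})) := by
    have := Derivation.apply_mem_comap_of_not_isRegularLocalRing (pderiv 1 : Derivation Λ (MvPolynomial (Fin 3) Λ) (MvPolynomial (Fin 3) Λ)) h P hP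
    rwa [hd1] at this
  have hX1 : (X 1 : MvPolynomial (Fin 3) Λ) ∈ P.comap (Ideal.Quotient.mk (Ideal.span {h})) := by
    have := Derivation.apply_mem_comap_of_not_isRegularLocalRing (pderiv 0 : Derivation Λ (MvPolynomial (Fin 3) Λ) (MvPolynomial (Fin 3) Λ)) h P hP
    rwa [hd0] at this
  have hCg : (C g : MvPolynomial (Fin 3) Λ) ∈ P.comap (Ideal.Quotient.mk (Ideal.span {h})) := by
    have := Derivation.apply_mem_comap_of_not_isRegularLocalRing (pderiv 2 : Derivation Λ (MvPolynomial (Fin 3) Λ) (MvPolynomial (Fin 3) Λ)) h P hP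
    rwa [hd2] at this
  have hX2 : (X 2 : MvPolynomial (Fin 3) Λ) ∈ P.comap (Ideal.Quotient.mk (Ideal.span {h})) := by
    have hw := Derivation.apply_mem_comap_of_not_isRegularLocalRing (coeffwiseDerivation (ι := Fin 3) D₀) h P hP
    rw [coeffwiseDerivation_h g h D₀ hh] at hw
    rcases hp.mem_or_mem hw with hw2 | hDg
    · exact hw2
    · exfalso
      apply hp.ne_top
      rw [Ideal.eq_top_iff_one]
      have hC : (C (D₀ g) * C s - C g * C t : MvPolynomial (Fin 3) Λ) = 1 := by
        rw [← map_mul, ← map_mul, ← map_sub, hst, add_sub_cancel_right, map_one]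
      rw [← hC]
      exact Ideal.sub_mem _ (Ideal.mul_mem_right _ _ hDg) (Ideal.mul_mem_right _ _ hCg)
  rw [Ideal.map_le_iff_le_comap, Ideal.span_le]
  rintro _ ⟨j, rfl⟩
  fin_cases j
  · exact h0 ▸ hX0
  · exact h1 ▸ hX1
  · exact h2 ▸ hX2
  · exact h3 ▸ hCg

/-- ★ **`Sing(Spec C_w) = V(J)`**: for `Λ` a regular domain, `g ≠ 0`, `Λ/(g)` with `D₀ g` a unit modulo `g`: a prime `P` of `C_w = R/(h)` is a SINGULAR point iff
`P ⊇ J` (`ODPCurveCentre.not_isRegularLocalRing_of_le` + `map_le_of_not_isRegularLocalRing`). This is the ring side of the E4″ (F2) chart identification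
«𝓚_E|_{D₊(wᵢ)} = (a′, b′, wᵢ, g)~». [cite: StacksProject, Tag 07PF] [cite: Matsumura1987, Thm. 14.2] -/
theorem not_isRegularLocalRing_iff_map_le [IsRegularRing Λ] [IsDomain Λ] (hg0 : g ≠ 0) {S₀ : Type v} [CommRing S₀] [Algebra S₀ Λ]
    (D₀ : Derivation S₀ Λ Λ) (hD₀ : IsUnit (Ideal.Quotient.mk (Ideal.span {g}) (D₀ g))) (hcen : cen = ![X 0, X 1, X 2, C g])
    (hh : h = X 0 * X 1 + X 2 * C g) (P : Ideal (MvPolynomial (Fin 3) Λ ⧸ Ideal.span {h})) [P.IsPrime] :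
    ¬ IsRegularLocalRing (Localization.AtPrime P) ↔ (Ideal.span (Set.range cen)).map (Ideal.Quotient.mk (Ideal.span {h})) ≤ P :=
  ⟨map_le_of_not_isRegularLocalRing g cen h D₀ hD₀ hcen hh P, ODPCurveCentre.not_isRegularLocalRing_of_le g cen h hg0 hcen hh P⟩

end Summit.ResolutionOfSingularities.ResolutionOfSingularities.Theorems.FInjectiveMacaulayfication.ODPCurveBlowupRegular

end
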